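import Summits.Parity.GeneralizedHardyLittlewood.Theorems.LeeYangFibresCellParityLawP2Defs
import HarnessLib

/-!
# Route `LeeYangFibres`, crux `CellParityLaw` (stmt-Parity-14109), line `section-annihilator`:
# the induction predicate of `KernelInduction` and its four registered pieces (skeleton v19 vocabulary)

Route-posited objects and statement types (D-0016 `<Route><Crux>…Defs` file; companion of
`LeeYangFibresCellParityLawKernelDefs.lean` and `LeeYangFibresCellParityLawP2Defs.lean`). NOTHING IS ASSERTED:
every `def … : Prop` is the type of a registered sub-goal of the stub `stub_kernelInduction : KernelInduction`
of skeleton v19 (`Cruxes/CellParityLaw/Lines/section_annihilator.lean`, continuation lead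
`prover-line-stmt-Parity-14109-c6-0`), and the only theorem is the pure-logic composition of those pieces into
`KernelInduction` (`stub_kernelInductionPieces : KernelInductionPieces`, registered bookkeeping sub-goal: induction on the
number of prime factors).

## What is being organised (lead c6, 2026-08-16)

`KernelInduction` (`…P2Defs`) says that the linear-sieve upper bound for the primes of an admissible sequence
(`PrimeUpperBound`), the exact Buchstab recursion over the least prime factor (`RecursionIdentity`), the
inheritance of admissibility by the fibres (`FibreInheritance`), the model prime sum (`ModelPrimeSum`) and the
effective weighted `P₂` law (`EffectiveWeightedP2Law`) imply the strong rough-cell law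
`EffectiveRoughCellLawStrong`. The proof (E. Bombieri, RIMS Kôkyûroku 294 (1977) p. 5, organised along the
least prime factor) is an induction on the cell index `m` of ONE statement, uniform over all admissible data,
with the parity parameter made EXPLICIT: `δ*(𝒜; x, z) = max 0 (2 − C₁/T)` (`cellDelta`; `C₁` = the primes of the
sequence in `(z, x]`, `T = e^γ V(z) A(x)/u'` the prime scale), i.e.

  `Q(m)`: `|C_m(𝒜; x, z) − (1 + (δ* − 1)(−1)^m) I_m(u') T| ≤ kernelErr C κ A₂ 𝒜 x z η Λ R`   (`CellLawAt m`)

for all kernel-admissible data with `x ≥ x₀`, `z ∈ [x^{1/(u+1)}, x^{1/2}]`, parameters in range, the constants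
`κ ∈ (0, 1]`, `C ≥ 0`, `η₀ > 0`, `A₂`, `x₀` depending on `m, u, A₁, L'` only.

* `Q(1)` (`InductionBaseOne`) is the clipping identity `|C₁ − (2 − δ*) T| ≤ (C₁ − 2T)⁺` plus `PrimeUpperBound`
  (`I_1(u') = 1` as `u' ≥ 2`).
* `Q(2)` (`InductionBaseTwo`) is the weighted `P₂` law at `j = 1` (`I_1 ≡ 1` on the rough pairs, so the weighted
  pair sum IS `C₂`; `I_2(u')(2T − C₁) = δ* I_2(u') T` up to the clip defect).
* `Q(1) ∧ Q(n) ⟹ Q(n+1)` for `n ≥ 2` (`InductionStepAt n`): recursion, the fibres `𝒜_p` (`z < p ≤ x^{1/(n+1)}`)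
  are admissible data at `(x/p, p − 1/2, η_p)` within the same roughness class, `Q(n)` and `Q(1)` for each fibre
  with ITS parameter `δ*_p`, the shift `log(p − 1/2) ↦ log p`, the model prime sum and the `P₂` law at `j = n`,
  the parity algebra at the parent (all tools landed: `…KernelInductionAux/Fibres/Sums/Step`).
* `(∀ m ≥ 1, Q(m)) ⟹ EffectiveRoughCellLawStrong` (`InductionPackage`): for `z ≥ x^{1/(u+1)}` the cells and
  the models with `m ≥ u + 2` vanish, and finitely many constants are merged by the monotonicity of `kernelErr`.

References: E. Bombieri, RIMS Kôkyûroku 294 (1977) p. 5 [BombieriRIMS1977]; E. Bombieri, Rend. Accad. Naz. XL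
(5) 1/2 (1975/76) [BombieriAsymptoticSieve1976]; J. Friedlander, H. Iwaniec, Ann. Sc. Norm. Sup. Pisa (4) 5
(1978) §4 [FriedlanderIwaniecPisa1978].
-/

noncomputable section

open scoped BigOperators Classical
open Finset Literature.NumberTheory.Sieve

namespace Summit.Parity.GeneralizedHardyLittlewood.Cruxes.CellParityLaw.SectionAnnihilator

/-! ## The explicit parity parameter and the induction predicate -/

/-- **The clipped parity parameter** `δ*(𝒜; x, z) = max 0 (2 − C₁(𝒜; x, z)/T(𝒜; x, z))`: Bombieri's `δ_x`,
read off from the primes of the sequence against the prime scale `T = primeMain 𝒜 x z`, clipped into `[0, 2]`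
(the upper clip `δ* ≤ 2` is automatic as `C₁, T ≥ 0`; `T = 0` gives `δ* = 2` by `x/0 = 0`). -/
def cellDelta (𝒜 : SieveSequence) (x z : ℝ) : ℝ :=
  max 0 (2 - roughCellSum 𝒜 x z 1 / primeMain 𝒜 x z)

/-- **The `m`-cell law with the explicit parameter** (`CellLawAt m`, the induction predicate `Q(m)`): for every
`u ≥ 2, A₁, L'` there are `κ ∈ (0, 1]`, `C ≥ 0`, `η₀ > 0`, `A₂`, `x₀` such that for all kernel-admissible data
with `x ≥ x₀`, `z ∈ [x^{1/(u+1)}, x^{1/2}]` and parameters in range,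
`|C_m(𝒜; x, z) − (1 + (δ* − 1)(−1)^m) I_m(log x/log z) T(𝒜; x, z)| ≤ kernelErr C κ A₂ 𝒜 x z η Λ R`,
`δ* = cellDelta 𝒜 x z`. (`EffectiveRoughCellLawStrong` with its `∃ δ` witnessed by `δ*`, one `m` at a time.) -/
def CellLawAt (m : ℕ) : Prop :=
  ∀ (u : ℕ) (A₁ L' : ℝ), 2 ≤ u → ∃ (κ C η₀ : ℝ) (A₂ : ℕ) (x₀ : ℝ), 0 < κ ∧ κ ≤ 1 ∧ 0 ≤ C ∧ 0 < η₀ ∧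
    ∀ (𝒜 : SieveSequence) (x z η Λ w₀ R : ℝ), x₀ ≤ x →
      x ^ (1 / ((u : ℝ) + 1)) ≤ z → z ≤ x ^ (1 / 2 : ℝ) →
      KernelRanges x η Λ w₀ η₀ → KernelAdmissible A₁ L' 𝒜 x η Λ w₀ R →
        |roughCellSum 𝒜 x z m -
            (1 + (cellDelta 𝒜 x z - 1) * (-1 : ℝ) ^ m) * roughCellDensity m (Real.log x / Real.log z) *
              primeMain 𝒜 x z|
          ≤ kernelErr C κ A₂ 𝒜 x z η Λ R

/-! ## The four pieces of the induction (types of the registered sub-goals of `stub_kernelInduction`) -/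

/-- **Base `m = 1`** (`InductionBaseOne`; sub-goal `stub_inductionBaseOne`): `Q(1)` from the linear-sieve upper
bound — `I_1(u') = 1` (`u' ≥ 2`), `(1 + (δ* − 1)(−1)) T = (2 − δ*) T`, and the clipping identity
`|C₁ − (2 − δ*) T| ≤ max 0 (C₁ − 2T) ≤ kernelErr` (`StepAux.clip_defect_le`, `PrimeUpperBound`). -/
def InductionBaseOne : Prop :=
  PrimeUpperBound → CellLawAt 1

/-- **Base `m = 2`** (`InductionBaseTwo`; sub-goal `stub_inductionBaseTwo`): `Q(2)` from the weighted `P₂` law at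
`j = 1` — on the rough pairs `q = pp'`, `z < p ≤ p'`, `pq ≤ x`, one has `log(x/p)/log p ≥ 1`, so `I_1 = 1` and
`weightedPairSum 𝒜 x z 1 = C₂(𝒜; x, z)`; the model `I_2(u')(2T − C₁)` differs from `δ* I_2(u') T
= (1 + (δ* − 1)(−1)²) I_2(u') T` by `I_2(u') · (clip defect) ≤ (u+1) · kernelErr` (`PrimeUpperBound`). -/
def InductionBaseTwo : Prop :=
  PrimeUpperBound → EffectiveWeightedP2Law → CellLawAt 2

/-- **The step at `n`** (`InductionStepAt n`, used for `n ≥ 2`; `InductionStep` is the type of the sub-goal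
`stub_inductionStep`): `Q(1) ∧ Q(n) ⟹ Q(n+1)` given the four provable inputs and the weighted `P₂` law —
Bombieri's recursion over the least prime factor: `C_{n+1}(𝒜; x, z) = Σ_{z<p≤x^{1/(n+1)}} C_n(𝒜_p; x/p, p − 1/2)`,
each fibre being admissible data in the same roughness class (`FibreInheritance`, `FibreDataAux`), `Q(n)` and
`Q(1)` at the fibre with its own `δ*_p` (`StepAux.fibre_pointwise`), then `Σ_p I_n(u_p) e^γ V(p) A_p(x)/u_p
≈ I_{n+1}(u') T` (`ModelPrimeSum`), `Σ_p I_n(u_p) π_p = weightedPairSum 𝒜 x z n ≈ I_{n+1}(u')(2T − C₁)`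
(`EffectiveWeightedP2Law`), the parity algebra at the parent (`StepAux.parent_bound`) and the fibre error sums
(`SumsAux.fibre_errors_sum`). -/
def InductionStepAt (n : ℕ) : Prop :=
  PrimeUpperBound → RecursionIdentity → FibreInheritance → ModelPrimeSum → EffectiveWeightedP2Law →
    CellLawAt 1 → CellLawAt n → CellLawAt (n + 1)

/-- **The step** (`InductionStep`; sub-goal `stub_inductionStep`): `InductionStepAt n` for every `n ≥ 2`. -/
def InductionStep : Prop :=
  ∀ n : ℕ, 2 ≤ n → InductionStepAt n

/-- **Packaging** (`InductionPackage`; sub-goal `stub_inductionPackage`): `Q(m)` for every `m ≥ 1` gives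
`EffectiveRoughCellLawStrong` — `δ := δ*` (in `[0, 2]` by `StepAux.clip_defect_le`); for `z ≥ x^{1/(u+1)}` both
`C_m(𝒜; x, z)` and `I_m(u')`, `u' = log x/log z ≤ u + 1`, vanish once `m ≥ u + 2`
(`VanishAux.roughCellSum_eq_zero_of_pow_le`, `roughCellDensity_of_lt`), and the finitely many constants for
`m ≤ u + 1` merge by `KernelErrAux.kernelErr_mono` (`κ := min`, `C := Σ`, `A₂ := max`, `x₀ := max`,
`η₀ := min`). -/
def InductionPackage : Prop :=
  (∀ m : ℕ, 1 ≤ m → CellLawAt m) → EffectiveRoughCellLawStrong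

/-! ## Composition (pure logic) -/

/-- **The pieces give `KernelInduction`** (`KernelInductionPieces`; type of the registered bookkeeping sub-goal
`stub_kernelInductionPieces`): pure logic — strong induction on the cell index. -/
def KernelInductionPieces : Prop :=
  InductionBaseOne → InductionBaseTwo → InductionStep → InductionPackage → KernelInduction

/-- **`stub_kernelInductionPieces`** (registered bookkeeping sub-goal of `stub_kernelInduction`, skeleton v19):
`Q(1)`, `Q(2)` from the bases, `Q(n+1)` from `Q(1) ∧ Q(n)` for `n ≥ 2`, then the packaging. -/
theorem stub_kernelInductionPieces : KernelInductionPieces := by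
  intro hB₁ hB₂ hS hP hU hRec hFib hMod hP2
  refine hP ?_
  have h1 : CellLawAt 1 := hB₁ hU
  have h2 : CellLawAt 2 := hB₂ hU hP2
  intro m hm
  induction m, hm using Nat.le_induction with
  | base => exact h1
  | succ k hk ih =>
    rcases Nat.lt_or_ge k 2 with hk2 | hk2
    · obtain rfl : k = 1 := by omega
      exact h2
    · exact hS k hk2 hU hRec hFib hMod hP2 h1 ih

end Summit.Parity.GeneralizedHardyLittlewood.Cruxes.CellParityLaw.SectionAnnihilator

end
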